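import Literature.NumberTheory.EllipticCurves.ModularFormsGamma0Genus
import HarnessLib

/-!
# The dimension formula for `M_k(Γ₀(N))` in large even weights, and the lower bound for
# `dim S_k(Γ₀(N))` (Diamond–Shurman Thm. 3.5.1 for `k ≥ 6μ`), by the free-module route

`ModularFormsGamma0FreeModule`, `ModularFormsGamma0Rank` and `ModularFormsGamma0Genus` proved,
without Riemann surfaces, that `A = M(Γ₀(N)) = ⊕ₖ M_k(Γ₀(N))` is free over `R = ℂ[E₄, E₆]` on
`μ = [SL₂(ℤ) : Γ₀(N)]` homogeneous generators of even weights `k_1, …, k_μ ≥ 0`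
(`exists_isLevelOneBasis_card_eq`) satisfying Gannon's constraints
`2#{4 ∣ k_j} = μ + ν₂`, `3#{6 ∣ k_j} = μ + 2ν₃`, `3#{k_j ≡ 2 (6)} = 3#{k_j ≡ 4 (6)} = μ - ν₃`
(`two_mul_card_four_dvd`, `three_mul_card_six_dvd`) and `∑ k_j = 6(μ - ν_∞)` (`totalWeight_eq`),
and used them in weight `2` only (`dim S₂(Γ₀(N)) = g(X₀(N))`). This file draws the consequence in
**every even weight `k ≥ max_j k_j`** (in particular for `k ≥ 6μ ≥ ∑ k_j`): since
`dim M_k(Γ₀(N)) = ∑_j dim R_{k-k_j}` (`IsLevelOneBasis.finrank_eq`) and, for even `w ≥ 0`,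

  `12 dim R_w + 6[4 ∤ w] + 8[w ≡ 2 (6)] + 4[w ≡ 4 (6)] = w + 12`      (`twelve_mul_finrank_levelOneSpace`)

(Mathlib's `ModularForm.dimension_level_one`), summing over `j` with `w = k - k_j` and inserting the
four constraints gives the classical formula

  `12 dim M_k(Γ₀(N)) = (k-1)μ + 6ν_∞ + 3ν₂ε₄(k) + 4ν₃ε₆(k)`,
  `ε₄ = 1, -1` for `k ≡ 0, 2 (4)`,  `ε₆ = 1, -1, 0` for `k ≡ 0, 2, 4 (6)`,

i.e. `dim M_k(Γ₀(N)) = (k-1)(g-1) + ⌊k/4⌋ν₂ + ⌊k/3⌋ν₃ + (k/2)ν_∞` (Diamond–Shurman Thm. 3.5.1,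
Shimura Thm. 2.23) — `twelve_mul_finrank_gamma0Space`, `finrank_modularForm_gamma0_eq` — and, since
the cusp-value map `M_k → ℂ^{cusps}` has kernel inside `S_k` (`finrank_gamma0Space_le_finrank_cuspForm_add`,
any weight), the lower bound

  `dim S_k(Γ₀(N)) ≥ (k-1)(g-1) + ⌊k/4⌋ν₂ + ⌊k/3⌋ν₃ + (k/2 - 1)ν_∞`   (`le_finrank_cuspForm_gamma0`)

for all even `k ≥ 6μ` — the existence half of Thm. 3.5.1 in those weights (the upper bound is the
other half of Riemann–Roch, equivalently the rank half of Eichler–Shimura; it is not proved here).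
For `N ≤ 4` (`Γ₀(N) = ±Γ₁(N)`) this is the dimension lower bound that the rank half of
Eichler–Shimura on `Γ₁(N)` consumes; for `Γ₁(N)`, `N ≥ 5`, the same bookkeeping applies verbatim to a
level-one basis of the even-weight forms on `Γ₁(N)` once the three files above are run for `±Γ₁(N)`
(no elliptic points: the `k_j` are then equidistributed modulo `4` and modulo `6`).

Everything is proved; there are no named facts. Auxiliary definitions: the weight-`k` cusp-value
maps `cuspValueK`, `cuspValuesK`, `cuspFormOfVanishingK`, `kerToCuspFormK` (the weight-`2` versions
are in `ModularFormsGamma0Genus`).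

## References

* F. Diamond, J. Shurman, *A first course in modular forms*, GTM 228, Springer (2005), Thm. 3.5.1
  (dimension formulas for `Γ₀(N)`-type groups, even weight), Thm. 3.1.1 (genus formula).
* G. Shimura, *Introduction to the arithmetic theory of automorphic functions*, Publ. Math. Soc.
  Japan 11 (1971), Thm. 2.23, Prop. 1.40, Prop. 1.43.
* T. Gannon, *The theory of vector-valued modular forms for the modular group*, Contrib. Math.
  Comput. Sci. 8 (2014), 247–286, Thm. 3.4 and §3.5 (dimension of `M_k` from the generating
  weights).
-/

noncomputable section

open UpperHalfPlane hiding I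
open ModularForm Complex Matrix.SpecialLinearGroup Filter Asymptotics CongruenceSubgroup
open EisensteinSeries ModularGroup
open scoped MatrixGroups Real ModularForm Topology Manifold

namespace Literature.NumberTheory.EllipticCurves.ModularForms

/-! ### Level one: `12 dim R_w + 6[4 ∤ w] + 8[w ≡ 2 (6)] + 4[w ≡ 4 (6)] = w + 12` -/

section LevelOne

/-- **`dim M_n(SL₂(ℤ))` for even `n`** (Mathlib's `ModularForm.dimension_level_one`, as a `finrank`
of the function space `levelOneSpace`): `⌊n/12⌋` if `n ≡ 2 (12)`, else `⌊n/12⌋ + 1`. [folklore] -/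
theorem finrank_levelOneSpace_natCast {n : ℕ} (hn : Even n) :
    Module.finrank ℂ (levelOneSpace (n : ℤ)) = if n % 12 = 2 then n / 12 else n / 12 + 1 := by
  rw [finrank_formSpace]
  have h := ModularForm.dimension_level_one n hn
  have : Module.finrank ℂ (ModularForm 𝒮ℒ n) = if n ≡ 2 [MOD 12] then n / 12 else n / 12 + 1 :=
    Module.finrank_eq_of_rank_eq (by rw [h])
  rw [this]
  simp only [Nat.ModEq, Nat.reduceMod]
  congr

/-- **The per-weight identity** behind the dimension formula: for even `w ≥ 0`,
`12 dim R_w + 6[4 ∤ w] + 8[w ≡ 2 (6)] + 4[w ≡ 4 (6)] = w + 12` (the equality case of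
`weight_ineq` of `ModularFormsGamma0Genus`, where `[w = 2]` accounts for `dim R₂ = 0`). [folklore] -/
theorem twelve_mul_finrank_levelOneSpace {w : ℤ} (h0 : 0 ≤ w) (he : Even w) :
    12 * (Module.finrank ℂ (levelOneSpace w) : ℤ) + 6 * (if ¬ (4 : ℤ) ∣ w then (1 : ℤ) else 0) +
        8 * (if w % 6 = 2 then (1 : ℤ) else 0) + 4 * (if w % 6 = 4 then (1 : ℤ) else 0) =
      w + 12 := by
  obtain ⟨n, rfl⟩ : ∃ n : ℕ, w = n := ⟨w.toNat, (Int.toNat_of_nonneg h0).symm⟩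
  have hn : Even n := by
    obtain ⟨a, ha⟩ := he
    exact Nat.even_iff.mpr (by omega)
  rw [finrank_levelOneSpace_natCast hn]
  have hn2 := Nat.even_iff.mp hn
  split_ifs <;> push_cast <;> omega

end LevelOne

/-! ### `12 dim M_k(Γ₀(N)) = (k-1)μ + 6ν_∞ + 3ν₂ε₄(k) + 4ν₃ε₆(k)` for even `k ≥ max k_j` -/

section Dimension

variable {N : ℕ} [NeZero N]
variable {wt : Fin (gamma0Index N) → ℤ} {F : Fin (gamma0Index N) → ℍ → ℂ}

/-- The sign `ε₄(k) = 1, -1` for `k ≡ 0, 2 (mod 4)` in the dimension formula (coefficient of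
`ν₂/4`: `⌊k/4⌋ - (k-1)/4`, times `4`). [cite: DiamondShurman2005, Thm. 3.5.1] -/
def eps4 (k : ℤ) : ℤ := if (4 : ℤ) ∣ k then 1 else -1

/-- The sign `ε₆(k) = 1, -1, 0` for `k ≡ 0, 2, 4 (mod 6)` in the dimension formula (coefficient of
`ν₃/3`: `⌊k/3⌋ - (k-1)/3`, times `3`). [cite: DiamondShurman2005, Thm. 3.5.1] -/
def eps6 (k : ℤ) : ℤ := if (6 : ℤ) ∣ k then 1 else if k % 6 = 2 then -1 else 0

/-- **The modulo-`4` count**: for even `k`, `2 · #{j : 4 ∤ k - k_j} = μ - ν₂ε₄(k)`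
(from `2#{4 ∣ k_j} = μ + ν₂`, `2#{4 ∤ k_j} + ν₂ = μ`). [cite: Gannon2014, Thm. 3.4(b)] -/
theorem two_mul_card_not_four_dvd_sub (hb : IsLevelOneBasis N wt F) (hwt : ∀ j, 0 ≤ wt j ∧ Even (wt j))
    {k : ℤ} (hk : Even k) :
    2 * ((Finset.univ.filter fun j ↦ ¬ (4 : ℤ) ∣ k - wt j).card : ℤ) =
      gamma0Index N - nu₂ N * eps4 k := by
  obtain ⟨h4, h4'⟩ := two_mul_card_four_dvd hb hwt
  unfold eps4
  by_cases hk4 : (4 : ℤ) ∣ k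
  · have heq : (Finset.univ.filter fun j ↦ ¬ (4 : ℤ) ∣ k - wt j) =
        Finset.univ.filter fun j ↦ ¬ (4 : ℤ) ∣ wt j :=
      Finset.filter_congr fun j _ ↦ by
        obtain ⟨a, ha⟩ := (hwt j).2
        omega
    rw [heq, if_pos hk4]
    omega
  · have heq : (Finset.univ.filter fun j ↦ ¬ (4 : ℤ) ∣ k - wt j) =
        Finset.univ.filter fun j ↦ (4 : ℤ) ∣ wt j :=
      Finset.filter_congr fun j _ ↦ by
        obtain ⟨a, ha⟩ := (hwt j).2
        obtain ⟨b, hb⟩ := hk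
        omega
    rw [heq, if_neg hk4]
    omega

/-- **The modulo-`6` count**: for even `k`,
`3 · (8 #{j : k - k_j ≡ 2 (6)} + 4 #{j : k - k_j ≡ 4 (6)}) = 12μ - 12ν₃ε₆(k)`
(from `3#{6 ∣ k_j} = μ + 2ν₃`, `3#{k_j ≡ 2 (6)} + ν₃ = μ = 3#{k_j ≡ 4 (6)} + ν₃`).
[cite: Gannon2014, Thm. 3.4(b)] -/
theorem three_mul_card_sub_mod_six (hb : IsLevelOneBasis N wt F) (hwt : ∀ j, 0 ≤ wt j ∧ Even (wt j))
    {k : ℤ} (hk : Even k) :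
    3 * (8 * ((Finset.univ.filter fun j ↦ (k - wt j) % 6 = 2).card : ℤ) +
        4 * ((Finset.univ.filter fun j ↦ (k - wt j) % 6 = 4).card : ℤ)) =
      12 * gamma0Index N - 12 * nu₃ N * eps6 k := by
  obtain ⟨h60, h62, h64⟩ := three_mul_card_six_dvd hb hwt
  obtain ⟨b, hbk⟩ := hk
  unfold eps6
  have hcases : k % 6 = 0 ∨ k % 6 = 2 ∨ k % 6 = 4 := by omega
  rcases hcases with h0 | h2 | h4
  · have e2 : (Finset.univ.filter fun j ↦ (k - wt j) % 6 = 2) = Finset.univ.filter fun j ↦ wt j % 6 = 4 :=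
      Finset.filter_congr fun j _ ↦ by obtain ⟨a, ha⟩ := (hwt j).2; omega
    have e4 : (Finset.univ.filter fun j ↦ (k - wt j) % 6 = 4) = Finset.univ.filter fun j ↦ wt j % 6 = 2 :=
      Finset.filter_congr fun j _ ↦ by obtain ⟨a, ha⟩ := (hwt j).2; omega
    rw [e2, e4, if_pos (by omega)]
    omega
  · have e2 : (Finset.univ.filter fun j ↦ (k - wt j) % 6 = 2) = Finset.univ.filter fun j ↦ (6 : ℤ) ∣ wt j :=
      Finset.filter_congr fun j _ ↦ by obtain ⟨a, ha⟩ := (hwt j).2; omega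
    have e4 : (Finset.univ.filter fun j ↦ (k - wt j) % 6 = 4) = Finset.univ.filter fun j ↦ wt j % 6 = 4 :=
      Finset.filter_congr fun j _ ↦ by obtain ⟨a, ha⟩ := (hwt j).2; omega
    rw [e2, e4, if_neg (by omega), if_pos h2]
    omega
  · have e2 : (Finset.univ.filter fun j ↦ (k - wt j) % 6 = 2) = Finset.univ.filter fun j ↦ wt j % 6 = 2 :=
      Finset.filter_congr fun j _ ↦ by obtain ⟨a, ha⟩ := (hwt j).2; omega
    have e4 : (Finset.univ.filter fun j ↦ (k - wt j) % 6 = 4) = Finset.univ.filter fun j ↦ (6 : ℤ) ∣ wt j :=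
      Finset.filter_congr fun j _ ↦ by obtain ⟨a, ha⟩ := (hwt j).2; omega
    rw [e2, e4, if_neg (by omega), if_neg (by omega)]
    omega

/-- **The dimension formula for `M_k(Γ₀(N))` from a level-one basis**: for even `k` with
`k ≥ k_j` for all `j`,
`12 dim M_k(Γ₀(N)) = (k-1)μ + 6ν_∞ + 3ν₂ε₄(k) + 4ν₃ε₆(k)`
(sum the per-weight identity over `w = k - k_j` and insert the cusp constraint `∑ k_j + 6ν_∞ = 6μ`
and the two elliptic counts). [cite: DiamondShurman2005, Thm. 3.5.1] -/
theorem twelve_mul_finrank_gamma0Space (hb : IsLevelOneBasis N wt F) (hwt : ∀ j, 0 ≤ wt j ∧ Even (wt j))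
    {k : ℤ} (hk : Even k) (hkw : ∀ j, wt j ≤ k) :
    12 * (Module.finrank ℂ (gamma0Space N k) : ℤ) =
      (k - 1) * gamma0Index N + 6 * nuInfty N + 3 * nu₂ N * eps4 k + 4 * nu₃ N * eps6 k := by
  classical
  have hK := totalWeight_eq hb hwt
  have h4 := two_mul_card_not_four_dvd_sub hb hwt hk
  have h6 := three_mul_card_sub_mod_six hb hwt hk
  -- sum the per-weight identity
  have hsum := Finset.sum_congr (rfl : (Finset.univ : Finset (Fin (gamma0Index N))) = _)
    fun j (_ : j ∈ (Finset.univ : Finset (Fin (gamma0Index N)))) ↦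
      twelve_mul_finrank_levelOneSpace (w := k - wt j) (by linarith [hkw j]) (hk.sub (hwt j).2)
  simp only [Finset.sum_add_distrib, ← Finset.mul_sum, Finset.sum_boole, Finset.sum_sub_distrib,
    Finset.sum_const, Finset.card_univ, Fintype.card_fin, nsmul_eq_mul] at hsum
  rw [hb.finrank_eq k]
  push_cast
  unfold totalWeight at hK
  nlinarith [hsum, hK, h4, h6]

variable (N)

/-- **`12 dim M_k(Γ₀(N)) = (k-1)μ + 6ν_∞ + 3ν₂ε₄(k) + 4ν₃ε₆(k)` for every even `k ≥ 6μ`**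
(`6μ ≥ ∑ k_j ≥ k_j`; Diamond–Shurman Thm. 3.5.1 in these weights, without Riemann–Roch).
[cite: DiamondShurman2005, Thm. 3.5.1] -/
theorem twelve_mul_finrank_modularForm_gamma0 {k : ℤ} (hk : Even k) (hk6 : 6 * (gamma0Index N : ℤ) ≤ k) :
    12 * (Module.finrank ℂ (ModularForm (Gamma0 N) k) : ℤ) =
      (k - 1) * gamma0Index N + 6 * nuInfty N + 3 * nu₂ N * eps4 k + 4 * nu₃ N * eps6 k := by
  obtain ⟨wt, F, hb, hwt⟩ := exists_isLevelOneBasis_card_eq N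
  have hK := totalWeight_eq hb hwt
  have hkw : ∀ j, wt j ≤ k := by
    intro j
    have h1 : wt j ≤ totalWeight N wt := by
      unfold totalWeight
      exact Finset.single_le_sum (fun i _ ↦ (hwt i).1) (Finset.mem_univ j)
    have h2 : (0 : ℤ) ≤ nuInfty N := Int.natCast_nonneg _
    linarith
  rw [← finrank_formSpace]
  exact twelve_mul_finrank_gamma0Space hb hwt hk hkw

/-- **The dimension formula `dim M_k(Γ₀(N)) = (k-1)(g-1) + ⌊k/4⌋ν₂ + ⌊k/3⌋ν₃ + (k/2)ν_∞`** for even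
`k ≥ 6μ` (with `12(g - 1) = μ - 3ν₂ - 4ν₃ - 6ν_∞`, `twelve_mul_genusX0_holds`).
[cite: DiamondShurman2005, Thm. 3.5.1] -/
theorem finrank_modularForm_gamma0_eq {k : ℕ} (hk : Even k) (hk6 : 6 * gamma0Index N ≤ k) :
    (Module.finrank ℂ (ModularForm (Gamma0 N) k) : ℤ) =
      ((k : ℤ) - 1) * ((genusX0 N : ℤ) - 1) + (k / 4 : ℕ) * nu₂ N + (k / 3 : ℕ) * nu₃ N +
        (k / 2 : ℕ) * nuInfty N := by
  have h := twelve_mul_finrank_modularForm_gamma0 N (k := k) (by exact_mod_cast hk) (by exact_mod_cast hk6)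
  have hg := twelve_mul_genusX0_holds N
  unfold twelve_mul_genusX0 at hg
  have hg' : (12 * genusX0 N + 3 * nu₂ N + 4 * nu₃ N + 6 * nuInfty N : ℤ) = 12 + gamma0Index N := by
    exact_mod_cast hg
  have hk2 := Nat.even_iff.mp hk
  have hA : (12 * (k / 4 : ℕ) : ℤ) = 3 * k - 3 + 3 * eps4 k := by
    unfold eps4; split_ifs <;> push_cast <;> omega
  have hB : (12 * (k / 3 : ℕ) : ℤ) = 4 * k - 4 + 4 * eps6 k := by
    unfold eps6; split_ifs <;> push_cast <;> omega
  have hC : (12 * (k / 2 : ℕ) : ℤ) = 6 * k := by push_cast; omega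
  have key : 12 * (Module.finrank ℂ (ModularForm (Gamma0 N) k) : ℤ) =
      12 * (((k : ℤ) - 1) * ((genusX0 N : ℤ) - 1) + (k / 4 : ℕ) * nu₂ N + (k / 3 : ℕ) * nu₃ N +
        (k / 2 : ℕ) * nuInfty N) := by
    linear_combination h - ((k : ℤ) - 1) * hg' - (nu₂ N : ℤ) * hA - (nu₃ N : ℤ) * hB -
      (nuInfty N : ℤ) * hC
  linarith

end Dimension

/-! ### The cusp-value map in weight `k`: `dim M_k(Γ₀(N)) ≤ dim S_k(Γ₀(N)) + ν_∞` -/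

section CuspValues

variable {N : ℕ} [NeZero N] {k : ℤ}

local notation "𝕏" => SL(2, ℤ) ⧸ Gamma0 N

open scoped Classical

/-- The local `Fintype` structure on the coset space. [folklore] -/
local instance fintypeCosetDimension : Fintype (SL(2, ℤ) ⧸ Gamma0 N) := Fintype.ofFinite _

variable (N k) in
/-- The **cusp-value functional** `f ↦ v(f ∣ x)` on `M_k(Γ₀(N))` (the weight-`k` twin of
`cuspValue` of `ModularFormsGamma0Genus`). [folklore] -/
def cuspValueK (x : 𝕏) : gamma0Space N k →ₗ[ℂ] ℂ where
  toFun f := valueAtInfty (cosetSlash N k (f : ℍ → ℂ) x)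
  map_add' f g := by
    have hadd : cosetSlash N k ((f : ℍ → ℂ) + g) x =
        cosetSlash N k (f : ℍ → ℂ) x + cosetSlash N k (g : ℍ → ℂ) x :=
      SlashAction.add_slash _ _ _ _
    simp only [Submodule.coe_add]
    rw [hadd]
    exact ((tendsto_cosetSlash f.2 x).add (tendsto_cosetSlash g.2 x)).limUnder_eq
  map_smul' c f := by
    have hsmul : cosetSlash N k (c • (f : ℍ → ℂ)) x = c • cosetSlash N k (f : ℍ → ℂ) x := by
      unfold cosetSlash
      rw [← ModularForm.SL_slash, ModularForm.SL_smul_slash, ModularForm.SL_slash]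
    simp only [Submodule.coe_smul, RingHom.id_apply]
    rw [hsmul]
    exact ((tendsto_cosetSlash f.2 x).const_smul c).limUnder_eq

/-- `cuspValueK` unfolded. [folklore] -/
theorem cuspValueK_apply (x : 𝕏) (f : gamma0Space N k) :
    cuspValueK N k x f = valueAtInfty (cosetSlash N k (f : ℍ → ℂ) x) := rfl

variable (N k) in
/-- The cusp-value map `M_k(Γ₀(N)) → ℂ^{base points}` (one coordinate per cusp). [folklore] -/
def cuspValuesK : gamma0Space N k →ₗ[ℂ] ({x // x ∈ basePoints N} → ℂ) :=
  LinearMap.pi fun b ↦ cuspValueK N k b.1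

/-- A `Γ₀(N)`-form of weight `k` all of whose conjugates vanish at `i∞` is a cusp form. [folklore] -/
def cuspFormOfVanishingK (f : ℍ → ℂ) (hf : f ∈ gamma0Space N k)
    (h0 : ∀ γ : SL(2, ℤ), IsZeroAtImInfty (f ∣[k] (γ : GL (Fin 2) ℝ))) : CuspForm (Gamma0 N) k where
  toFun := f
  slash_action_eq' γ hγ := slash_eq_of_mem_formSpace hf hγ
  holo' := mdifferentiable_of_mem_formSpace hf
  zero_at_cusps' {c} hc := by
    rw [Subgroup.IsArithmetic.isCusp_iff_isCusp_SL2Z] at hc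
    rw [OnePoint.isZeroAt_iff_forall_SL2Z hc]
    intro γ _
    exact h0 γ

/-- Members of `ker(cuspValuesK)` vanish at every cusp (the value at `i∞` is constant on
`T`-orbits, `valueAtInfty_cosetSlash_eq_base`). [folklore] -/
theorem isZeroAtImInfty_of_mem_ker_cuspValuesK {f : gamma0Space N k}
    (hf : f ∈ LinearMap.ker (cuspValuesK N k)) (γ : SL(2, ℤ)) :
    IsZeroAtImInfty ((f : ℍ → ℂ) ∣[k] (γ : GL (Fin 2) ℝ)) := by
  have hx : ∀ x : 𝕏, valueAtInfty (cosetSlash N k (f : ℍ → ℂ) x) = 0 := by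
    intro x
    rw [valueAtInfty_cosetSlash_eq_base f.2]
    have := congr_fun (LinearMap.mem_ker.mp hf) ⟨base N x, base_mem_basePoints x⟩
    exact this
  have heq : (f : ℍ → ℂ) ∣[k] (γ : GL (Fin 2) ℝ) =
      cosetSlash N k (f : ℍ → ℂ) ((γ⁻¹ : SL(2, ℤ)) : 𝕏) := by
    rw [cosetSlash_mk (slash_eq_of_mem_gamma0Space f.2), inv_inv]
  rw [heq]
  have := tendsto_cosetSlash f.2 ((γ⁻¹ : SL(2, ℤ)) : 𝕏)
  rwa [hx] at this

variable (N k) in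
/-- The inclusion `ker(cuspValuesK) → S_k(Γ₀(N))`. [folklore] -/
def kerToCuspFormK : LinearMap.ker (cuspValuesK N k) →ₗ[ℂ] CuspForm (Gamma0 N) k where
  toFun f := cuspFormOfVanishingK (f.1 : ℍ → ℂ) f.1.2 (isZeroAtImInfty_of_mem_ker_cuspValuesK f.2)
  map_add' f g := by ext τ; rfl
  map_smul' c f := by ext τ; rfl

/-- The inclusion is injective. [folklore] -/
theorem kerToCuspFormK_injective : Function.Injective (kerToCuspFormK N k) := by
  intro f g h
  apply Subtype.ext
  apply Subtype.ext
  funext τ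
  exact congrArg (fun G : CuspForm (Gamma0 N) k ↦ G τ) h

variable (N k) in
/-- **`dim M_k(Γ₀(N)) ≤ dim S_k(Γ₀(N)) + ν_∞`** in every weight: the cusp-value map to `ℂ^{ν_∞}`
has kernel consisting of cusp forms. [folklore] -/
theorem finrank_gamma0Space_le_finrank_cuspForm_add :
    Module.finrank ℂ (gamma0Space N k) ≤ Module.finrank ℂ (CuspForm (Gamma0 N) k) + nuInfty N := by
  haveI : FiniteDimensional ℂ (CuspForm (Gamma0 N) k) := finiteDimensional_cuspForm_gamma0 N k
  have hrn := LinearMap.finrank_range_add_finrank_ker (cuspValuesK N k)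
  have h1 : Module.finrank ℂ (LinearMap.range (cuspValuesK N k)) ≤ (basePoints N).card := by
    have := Submodule.finrank_le (LinearMap.range (cuspValuesK N k))
    rwa [Module.finrank_fintype_fun_eq_card, Fintype.card_coe] at this
  have h3 : Module.finrank ℂ (LinearMap.ker (cuspValuesK N k)) ≤
      Module.finrank ℂ (CuspForm (Gamma0 N) k) :=
    LinearMap.finrank_le_finrank_of_injective (kerToCuspFormK_injective (N := N) (k := k))
  rw [card_basePoints] at h1
  omega

end CuspValues

/-! ### Assembly: the lower bound for `dim S_k(Γ₀(N))`, even `k ≥ 6μ` -/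

section Assembly

variable (N : ℕ) [NeZero N]

/-- **`12 dim S_k(Γ₀(N)) ≥ (k-1)μ - 6ν_∞ + 3ν₂ε₄(k) + 4ν₃ε₆(k)` for even `k ≥ 6μ`** — the
existence half of Diamond–Shurman Thm. 3.5.1 (`dim S_k = dim M_k - ν_∞` for `k ≥ 4`) in these
weights, by the free-module route. [cite: DiamondShurman2005, Thm. 3.5.1] -/
theorem le_twelve_mul_finrank_cuspForm_gamma0 {k : ℤ} (hk : Even k) (hk6 : 6 * (gamma0Index N : ℤ) ≤ k) :
    (k - 1) * gamma0Index N - 6 * nuInfty N + 3 * nu₂ N * eps4 k + 4 * nu₃ N * eps6 k ≤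
      12 * (Module.finrank ℂ (CuspForm (Gamma0 N) k) : ℤ) := by
  have h1 := twelve_mul_finrank_modularForm_gamma0 N hk hk6
  have h2 := finrank_gamma0Space_le_finrank_cuspForm_add N k
  rw [finrank_formSpace] at h2
  have h2' : (Module.finrank ℂ (ModularForm (Gamma0 N) k) : ℤ) ≤
      Module.finrank ℂ (CuspForm (Gamma0 N) k) + nuInfty N := by exact_mod_cast h2
  linarith

/-- **`dim S_k(Γ₀(N)) ≥ (k-1)(g-1) + ⌊k/4⌋ν₂ + ⌊k/3⌋ν₃ + (k/2 - 1)ν_∞` for even `k ≥ 6μ`**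
(Diamond–Shurman Thm. 3.5.1, existence half, in these weights; the right-hand side is the exact
dimension for `k ≥ 4`). [cite: DiamondShurman2005, Thm. 3.5.1] -/
theorem le_finrank_cuspForm_gamma0 {k : ℕ} (hk : Even k) (hk6 : 6 * gamma0Index N ≤ k) :
    ((k : ℤ) - 1) * ((genusX0 N : ℤ) - 1) + (k / 4 : ℕ) * nu₂ N + (k / 3 : ℕ) * nu₃ N +
        ((k / 2 : ℕ) - 1 : ℤ) * nuInfty N ≤
      Module.finrank ℂ (CuspForm (Gamma0 N) k) := by
  have h := le_twelve_mul_finrank_cuspForm_gamma0 N (k := k) (by exact_mod_cast hk) (by exact_mod_cast hk6)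
  have hg := twelve_mul_genusX0_holds N
  unfold twelve_mul_genusX0 at hg
  have hg' : (12 * genusX0 N + 3 * nu₂ N + 4 * nu₃ N + 6 * nuInfty N : ℤ) = 12 + gamma0Index N := by
    exact_mod_cast hg
  have hk2 := Nat.even_iff.mp hk
  have hA : (12 * (k / 4 : ℕ) : ℤ) = 3 * k - 3 + 3 * eps4 k := by
    unfold eps4; split_ifs <;> push_cast <;> omega
  have hB : (12 * (k / 3 : ℕ) : ℤ) = 4 * k - 4 + 4 * eps6 k := by
    unfold eps6; split_ifs <;> push_cast <;> omega
  have hC : (12 * (k / 2 : ℕ) : ℤ) = 6 * k := by push_cast; omega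
  have key : 12 * (((k : ℤ) - 1) * ((genusX0 N : ℤ) - 1) + (k / 4 : ℕ) * nu₂ N + (k / 3 : ℕ) * nu₃ N +
        ((k / 2 : ℕ) - 1 : ℤ) * nuInfty N) =
      ((k : ℤ) - 1) * gamma0Index N - 6 * nuInfty N + 3 * nu₂ N * eps4 k + 4 * nu₃ N * eps6 k := by
    linear_combination ((k : ℤ) - 1) * hg' + (nu₂ N : ℤ) * hA + (nu₃ N : ℤ) * hB +
      (nuInfty N : ℤ) * hC
  linarith

end Assembly

end Literature.NumberTheory.EllipticCurves.ModularForms
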